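import Literature.AlgebraicGeometry.Resolution.Blowups
import Literature.AlgebraicGeometry.Resolution.AlterationsNormalFormBlowupParts
import HarnessLib

/-!
# Coherent junction sections separate the branches (crux `EquisingularLiftNat` = EL♮,
# stmt-ResolutionOfSingularities-20038; child EL♮(3) stmt-ResolutionOfSingularities-20148; device rule R-ii)

[OURS · L1 W4.5(b)] Helper for the research stub `stub_elnat_three_isolated_nontc` of the crux
`EquisingularLiftNat` (route `EquisingularLift`, chain w45b; res-L1-w45b-plan-1 UNCLAIMED-STUB LIST W4.5b
2026-08-27T08:44:06Z object U4 `CoherentJunctionSections`; CRUX-PLAN v3.1 D5 «`CoherentJunctionSections`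
(s_j := C₃ ∩ C₄ Hensel; St C₃, St C₄ O-smooth and disjoint after Bl_{s_j})»; PREREG-K45d ADDENDUM-1 P1-B′/P3′ and
PREREG-K45d-bis rule R-ii «junction SECTIONS first (coherent: s_j := C₃ ∩ C₄ upstairs) … coherence R-ii is
NECESSARY»). NOT a statement of the manuscript under review (Hironaka 2017); nothing here is attributed to its
author. AI-written kernel lemma of the cell `res-hironaka`, weaker than expert review.

**The device.** At a junction point `q` of two branches `C₃ = V(A)`, `C₄ = V(B)` (double curves of the
special fibre of unequal resolution depth, where the Δ-centre dies — kill test #42, table rows S-B, «Δ-JUNCTION-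
DAMAGE 12/12»), the line's order is SECTIONS FIRST: blow up the junction, then the separated branches component-
wise. The junction centre must be **coherent**: the scheme-theoretic intersection `s := C₃ ∩ C₄ = V(A ⊔ B)`
(an `O`-section through `q` by Hensel when the junction is transversal), NOT an arbitrary section through `q`.
This file proves the half of the device that explains the word «coherent», chart-free and for arbitrary schemes:

* `not_mem_strictTransformSet_of_mem_basicOpen` — the one-sided local statement;
* `strictTransformSet_disjoint_of_isEffectiveCartier_comap_sup` — **if `π : X' → X` pulls `V(A ⊔ B)` back
  to an effective Cartier divisor, the strict transforms of `V(A)` and `V(B)` (closures of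
  `π⁻¹(V(A) ∖ V(A ⊔ B))`, `π⁻¹(V(B) ∖ V(A ⊔ B))`, tree `strictTransformSet`) are DISJOINT**;
* `CoherentJunctionSections` — the same for a blow-up `π` of `X` along `A ⊔ B` (tree `IsBlowup`): Hartshorne,
  *Algebraic Geometry*, Exercise II.7.12 («blow up `𝓘_Y + 𝓘_Z`; the strict transforms of `Y` and `Z` do not
  meet»), here without Noetherian hypotheses;
* `coherentJunctionSections_of_eq` / `exists_isOpen_forall_not_mem_strictTransformSet` — the forms consumed by
  the chain (centre `C` with `C = A ⊔ B`; every point of `X'` has an open neighbourhood missing one of the two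
  strict transforms).

**Proof.** Only the Cartier property of `(A ⊔ B)·𝒪_{X'} = A·𝒪_{X'} + B·𝒪_{X'}` is used. Near `x' ∈ X'` pick an
affine `V` and a regular `g` with `(A ⊔ B)·𝒪(V) = (g)`; write `g = ug + vg` with `ug ∈ A·𝒪(V)`, `vg ∈ B·𝒪(V)`;
`g` regular forces `u + v = 1`, so `u` or `v` is a unit in the local ring `𝒪_{X',x'}`. If `u` is: on the basic
open `D(u) ∋ x'` the zero loci of `A·𝒪` and of `(g) = (A ⊔ B)·𝒪` agree, so `π⁻¹(V(A) ∖ V(A ⊔ B))` misses the open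
`D(u)` and `x'` is not in its closure. Hence no point lies on both strict transforms.

What is NOT here (other halves of R-ii, not re-derived): existence of the section by Hensel / the local algebra
«transversal junction ⇒ `𝒪_{P,q}/(f₃, f₄)` is a DVR with uniformizer `ϖ`»; `St C₃ ≅ C₃` stays `O`-smooth
(instance of `inCarrier_stepData_of_le`, `…EquisingularLiftNatInCarrierCentre.lean`).
References: R. Hartshorne, *Algebraic Geometry* (1977), Ch. II Ex. 7.12 [Hartshorne1977]; U. Görtz, T. Wedhorn,
*Algebraic Geometry I* (2020), Def. 13.90, (13.19) [GortzWedhorn2020].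
-/

-- single-problem summit: the doubled namespace component `ResolutionOfSingularities` is forced
set_option linter.dupNamespace false

noncomputable section

open CategoryTheory AlgebraicGeometry TopologicalSpace Topology
open Literature.AlgebraicGeometry.Resolution

namespace Summit.ResolutionOfSingularities.ResolutionOfSingularities.Theorems.EquisingularLift.Junction

universe u

variable {X' X : Scheme.{u}}

/-! ## A regular generator of `𝔞 ⊔ 𝔟` with `𝔞, 𝔟 ≤ (g)` splits along a partition of unity -/

/-- If `g` is a non-zero-divisor, `𝔞, 𝔟 ≤ (g)` and `g ∈ 𝔞 ⊔ 𝔟`, then `g = ug + vg` with `ug ∈ 𝔞`,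
`vg ∈ 𝔟` and `u + v = 1`. [folklore] -/
theorem exists_add_eq_one_of_mem_sup_of_le_span {S : Type*} [CommRing S] {g : S}
    (hg : g ∈ nonZeroDivisors S) {𝔞 𝔟 : Ideal S} (ha : 𝔞 ≤ Ideal.span {g}) (hb : 𝔟 ≤ Ideal.span {g})
    (hmem : g ∈ 𝔞 ⊔ 𝔟) : ∃ u v : S, u + v = 1 ∧ u * g ∈ 𝔞 ∧ v * g ∈ 𝔟 := by
  obtain ⟨a, ha', b, hb', hab⟩ := Submodule.mem_sup.mp hmem
  obtain ⟨u, rfl⟩ := Ideal.mem_span_singleton'.mp (ha ha')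
  obtain ⟨v, rfl⟩ := Ideal.mem_span_singleton'.mp (hb hb')
  refine ⟨u, v, ?_, ha', hb'⟩
  have h0 : (u + v - 1) * g = 0 := by
    rw [sub_mul, add_mul, one_mul, hab, sub_self]
  have h1 := (mem_nonZeroDivisors_iff_right.mp hg) _ h0
  exact sub_eq_zero.mp h1

/-! ## One-sided local statement -/

/-- **One side of a coherent junction is invisible on a basic open.** Let `π : X' → X`, `A, B` ideal sheaves
on `X`, `V ⊆ X'` affine with `(A ⊔ B)·𝒪(V) = (g)` and `ug ∈ A·𝒪(V)`. Then no point of the basic open `D(u)`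
lies on the strict transform of `V(A)` (the closure of `π⁻¹(V(A) ∖ V(A ⊔ B))`): on `D(u)` the zero locus of
`A·𝒪` is already the zero locus of `(g) = (A ⊔ B)·𝒪`. [cite: Hartshorne1977, Ch. II Ex. 7.12] -/
theorem not_mem_strictTransformSet_of_mem_basicOpen {π : X' ⟶ X} {A B : X.IdealSheafData}
    {V : X'.affineOpens} {g u : Γ(X', V)} (hg : ((A ⊔ B).comap π).ideal V = Ideal.span {g})
    (hu : u * g ∈ (A.comap π).ideal V) {x' : X'} (hx' : x' ∈ X'.basicOpen u) :
    x' ∉ strictTransformSet π ((A ⊔ B).support : Set X) (A.support : Set X) := by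
  intro hx
  have hdisj : Disjoint (π ⁻¹' ((A.support : Set X) \ ((A ⊔ B).support : Set X)))
      (X'.basicOpen u : Set X') := by
    rw [Set.disjoint_left]
    rintro y ⟨hyA, hyAB⟩ hyu
    apply hyAB
    have hyV : y ∈ (V : X'.Opens) := X'.basicOpen_le u hyu
    -- `y` lies on `V(A·𝒪_{X'})`
    have hyA' : y ∈ ((A.comap π).support : Set X') := by
      rw [Scheme.IdealSheafData.support_comap]
      exact hyA
    rw [SetLike.mem_coe, Scheme.IdealSheafData.mem_support_iff_of_mem hyV,
      Scheme.mem_zeroLocus_iff] at hyA'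
    -- hence `y ∉ D(g)` (as `y ∈ D(u)` and `y ∉ D(ug)`)
    have hyg : y ∉ X'.basicOpen g := by
      intro hyg
      apply hyA' (u * g) hu
      rw [Scheme.basicOpen_mul]
      exact ⟨hyu, hyg⟩
    -- so `y` lies on `V((g)) = V((A ⊔ B)·𝒪_{X'}) = π⁻¹ V(A ⊔ B)`
    have hyAB' : y ∈ (((A ⊔ B).comap π).support : Set X') := by
      rw [SetLike.mem_coe, Scheme.IdealSheafData.mem_support_iff_of_mem hyV, hg,
        Scheme.mem_zeroLocus_iff]
      intro f hf
      obtain ⟨c, rfl⟩ := Ideal.mem_span_singleton'.mp hf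
      rw [Scheme.basicOpen_mul]
      exact fun h => hyg h.2
    rw [Scheme.IdealSheafData.support_comap] at hyAB'
    exact hyAB'
  exact Set.disjoint_left.mp (hdisj.closure_left (X'.basicOpen u).isOpen) hx hx'

/-! ## The separation theorem -/

/-- **Blowing up a coherent junction separates the branches** (only the Cartier property is used). If
`π : X' → X` pulls `V(A ⊔ B) = V(A) ∩ V(B)` back to an effective Cartier divisor, then the strict transforms of
`V(A)` and `V(B)` under `π` (with respect to the centre `V(A ⊔ B)`) are disjoint. Hartshorne II Ex. 7.12, for
arbitrary schemes and quasi-coherent ideals. [cite: Hartshorne1977, Ch. II Ex. 7.12] -/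
theorem strictTransformSet_disjoint_of_isEffectiveCartier_comap_sup (π : X' ⟶ X)
    (A B : X.IdealSheafData) (h : IsEffectiveCartier ((A ⊔ B).comap π)) :
    Disjoint (strictTransformSet π ((A ⊔ B).support : Set X) (A.support : Set X))
      (strictTransformSet π ((A ⊔ B).support : Set X) (B.support : Set X)) := by
  rw [Set.disjoint_left]
  intro x' hxA hxB
  obtain ⟨V, hxV, g, hg, hIV⟩ := h x'
  -- `g ∈ A·𝒪(V) + B·𝒪(V)` and both lie in `(g)`
  have hsup : ((A ⊔ B).comap π).ideal V = (A.comap π).ideal V ⊔ (B.comap π).ideal V := by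
    rw [Scheme.IdealSheafData.comap_sup]
    rfl
  have hgmem : g ∈ (A.comap π).ideal V ⊔ (B.comap π).ideal V := by
    rw [← hsup, hIV]
    exact Ideal.mem_span_singleton_self g
  have hale : (A.comap π).ideal V ≤ Ideal.span {g} := by
    rw [← hIV]
    exact Scheme.IdealSheafData.le_def.mp (Scheme.IdealSheafData.comap_mono (f := π) le_sup_left) V
  have hble : (B.comap π).ideal V ≤ Ideal.span {g} := by
    rw [← hIV]
    exact Scheme.IdealSheafData.le_def.mp (Scheme.IdealSheafData.comap_mono (f := π) le_sup_right) V
  obtain ⟨u, v, huv, hu, hv⟩ := exists_add_eq_one_of_mem_sup_of_le_span hg hale hble hgmem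
  -- in the local ring `𝒪_{X',x'}` one of `u`, `v` is a unit
  have hunit : IsUnit (X'.presheaf.germ V x' hxV (u + v)) := by
    rw [huv, map_one]
    exact isUnit_one
  rw [map_add] at hunit
  rcases IsLocalRing.isUnit_or_isUnit_of_isUnit_add hunit with hu' | hv'
  · exact not_mem_strictTransformSet_of_mem_basicOpen hIV hu ((X'.mem_basicOpen u x' hxV).mpr hu') hxA
  · have hIV' : ((B ⊔ A).comap π).ideal V = Ideal.span {g} := by rw [sup_comm]; exact hIV
    have hxB' : x' ∈ strictTransformSet π ((B ⊔ A).support : Set X) (B.support : Set X) := by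
      rw [sup_comm]; exact hxB
    exact not_mem_strictTransformSet_of_mem_basicOpen hIV' hv ((X'.mem_basicOpen v x' hxV).mpr hv') hxB'

/-- **`CoherentJunctionSections`** (res-L1-w45b-plan-1 UNCLAIMED-STUB LIST W4.5b U4; CRUX-PLAN v3.1 D5; rule R-ii
of PREREG-K45d-bis). For a blow-up `π : X' → X` of ANY scheme `X` along the **coherent junction**
`V(A ⊔ B) = V(A) ∩ V(B)` of two closed subschemes `V(A)`, `V(B)` (e.g. the scheme-theoretic intersection
`s_j := C₃ ∩ C₄` of two branches of the carrier, an `O`-section at a transversal junction), the strict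
transforms of `V(A)` and `V(B)` are disjoint: the branches are SEPARATED by the sections-first step. (An
arbitrary section through the junction point does not do this — the reason coherence is necessary in R-ii.)
Hartshorne II Ex. 7.12 without Noetherian hypotheses. OURS; crux `EquisingularLiftNat`
(stmt-ResolutionOfSingularities-20038, child stmt-ResolutionOfSingularities-20148), not a statement of the manuscript under review.
[cite: Hartshorne1977, Ch. II Ex. 7.12] -/
theorem CoherentJunctionSections :
    ∀ (X' X : Scheme.{u}) (π : X' ⟶ X) (A B : X.IdealSheafData), IsBlowup π (A ⊔ B) →
      Disjoint (strictTransformSet π ((A ⊔ B).support : Set X) (A.support : Set X))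
        (strictTransformSet π ((A ⊔ B).support : Set X) (B.support : Set X)) :=
  fun _ _ π A B h => strictTransformSet_disjoint_of_isEffectiveCartier_comap_sup π A B h.isEffectiveCartier

/-- **Consumable form, centre named.** If `π` is a blow-up along `C` and `C = A ⊔ B` (the centre IS the
scheme-theoretic intersection of the two branches), then the strict transforms of the closed sets `V(A)`,
`V(B)` with respect to the centre `V(C) = V(A) ∩ V(B)` are disjoint. [cite: Hartshorne1977, Ch. II Ex. 7.12] -/
theorem coherentJunctionSections_of_eq {π : X' ⟶ X} {C A B : X.IdealSheafData} (hπ : IsBlowup π C)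
    (hC : C = A ⊔ B) :
    Disjoint (strictTransformSet π ((A.support : Set X) ∩ (B.support : Set X)) (A.support : Set X))
      (strictTransformSet π ((A.support : Set X) ∩ (B.support : Set X)) (B.support : Set X)) := by
  subst hC
  have hAB : ((A ⊔ B).support : Set X) = (A.support : Set X) ∩ (B.support : Set X) := by
    rw [Scheme.IdealSheafData.support_sup]
    rfl
  rw [← hAB]
  exact CoherentJunctionSections X' X π A B hπ

/-- **Pointwise form.** Under the hypothesis of `strictTransformSet_disjoint_of_isEffectiveCartier_comap_sup`,
every point of `X'` has an open neighbourhood which misses the strict transform of `V(A)` or misses the strict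
transform of `V(B)`. [cite: Hartshorne1977, Ch. II Ex. 7.12] -/
theorem exists_isOpen_forall_not_mem_strictTransformSet (π : X' ⟶ X) (A B : X.IdealSheafData)
    (h : IsEffectiveCartier ((A ⊔ B).comap π)) (x' : X') :
    ∃ W : Set X', IsOpen W ∧ x' ∈ W ∧
      ((∀ y ∈ W, y ∉ strictTransformSet π ((A ⊔ B).support : Set X) (A.support : Set X)) ∨
        (∀ y ∈ W, y ∉ strictTransformSet π ((A ⊔ B).support : Set X) (B.support : Set X))) := by
  have hd := strictTransformSet_disjoint_of_isEffectiveCartier_comap_sup π A B h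
  by_cases hxA : x' ∈ strictTransformSet π ((A ⊔ B).support : Set X) (A.support : Set X)
  · -- `x'` is off the (closed) strict transform of `V(B)`
    refine ⟨(strictTransformSet π ((A ⊔ B).support : Set X) (B.support : Set X))ᶜ,
      (strictTransformSet.isClosed π _ _).isOpen_compl, ?_, Or.inr fun y hy => hy⟩
    exact fun hxB => Set.disjoint_left.mp hd hxA hxB
  · exact ⟨(strictTransformSet π ((A ⊔ B).support : Set X) (A.support : Set X))ᶜ,
      (strictTransformSet.isClosed π _ _).isOpen_compl, hxA, Or.inl fun y hy => hy⟩

end Summit.ResolutionOfSingularities.ResolutionOfSingularities.Theorems.EquisingularLift.Junction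

end
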